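import Literature.Computability.AlgebraicComplexity.FlipGraphDiagonalStart
import Literature.Computability.AlgebraicComplexity.FlipGraphStandardToStrassen
import HarnessLib

/-!
# The flip graph with symmetry (Moosbauer–Poole 2025, Def. 5) and its non-connectivity over `𝔽₂`

Topic `Literature/Computability/AlgebraicComplexity`; companion of `FlipGraphOrbitFlips.lean` (MP
Thm. 4: orbit flips / orbit reductions / orbit plus-transitions as constructions) and
`FlipGraphConnectivity.lean` (KM Def. 4 `Flips`, Def. 2/Prop. 3 `Reduces`, MP Def. 3 plus-transition
identity). Source: J. Moosbauer, M. Poole, *Flip Graphs with Symmetry and New Matrix Multiplication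
Schemes*, ISSAC 2025 = arXiv:2502.04514 (MP), §3 (Def. 5 and the paragraph after it) and §4 (first
paragraph). Everything here is PROVED; there are no named facts.

## The printed statements

* **Def. 5** (verbatim): "Let `n ∈ ℕ` and let `G` be a finite subgroup of the symmetry group of matrix
  multiplication. Let `V` be the set of `G`-invariant `n × n`-matrix multiplication schemes. We define
  `E₁ = {(S,S') | S' is an orbit flip of S}`, `E₂ = {(S,S') | S' is an orbit reduction of S}`,
  `E₃ = {(S,S') | S' is an orbit plus-transition of S}`. The graph `(V, E₁ ∪ E₂ ∪ E₃)` is called the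
  `(n,n,n)`-flip graph with symmetry group `G`."  (Thm. 4 and the paragraph after it define the three
  operations: two representatives `A⊗B⊗C`, `A'⊗B'⊗C'` of different orbits of size `|G|` are replaced,
  orbit-wise, by the pieces `G·λ_X X` of the flip / reduction / plus-transition `P` of the pair,
  MP Def. 3, "for arbitrary permutations of `A, B` and `C`".)
* **§3, after Def. 5** (verbatim): "if the group order and the characteristic of the ground field are
  not coprime, then certain schemes cannot be connected in the flip graph. For example take `K = F₂`.
  Strassen's algorithm contains the rank-one tensor `(a₁₁+a₂₂)(b₁₁+b₂₂)(c₁₁+c₂₂)`. Any flip,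
  reduction or plus-transition that generates this rank-one tensor would generate it `6` times, so it
  becomes `0` over `F₂`. … So if we start from any `C₃ × ℤ₂` invariant `2 × 2` matrix multiplication
  scheme that does not already contain `(a₁₁+a₂₂)(b₁₁+b₂₂)(c₁₁+c₂₂)` then there is no path to
  Strassen's algorithm in the flip graph."
* **§4** (verbatim): "Some of these rank-one tensors are `C₃`-invariant. … Such rank-one tensors will
  not be replaced when we follow a path in the flip graph."

## What is typed (tree vocabulary: `Scheme t` = KM Def. 1 multisets; `orbitFinset`, `orbitPiece`,
`orbitCoeff` of `FlipGraphOrbitFlips.lean`; a finite group `G` acting on the tensor space, by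
symmetries `ρ : G → Symmetry t` where invariance is concerned)

* `OrbitMoveVia G S S' T₁ T₂ P` — the common shape of the three operations (Thm. 4): `T₁, T₂ ∈ S`
  with different orbits of size `|G|`, `Σ P = T₁ + T₂`, and
  `S' = S − (G·T₁ + G·T₂) + Σ_{X ∈ P} G·λ_X X` (multisets).
* `PlusBase` / `PlusTransitions` — MP Def. 3's plus-transition of a pair, written case and all six
  slot permutations (the flips and reductions of a pair are KM's `Flips` / `Reduces` of
  `FlipGraphConnectivity.lean`, applied to the two-element multiset `{T₁, T₂}`).
* `OrbitFlip`, `OrbitReduction`, `OrbitPlusTransition`, their union `OrbitAdj`, and **MP Def. 5**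
  `flipGraphSym ρ` on the vertex type of `G`-invariant schemes; `OrbitMoveVia.isInvariantUnder`
  (edges stay in `V`, = Thm. 4), `OrbitMoveVia.rank_eq` (rank bookkeeping).
* §4's sentence: `OrbitMoveVia.mem_of_card_lt` — an element whose orbit is smaller than `|G|` is never
  removed by an orbit move.
* The non-connectivity mechanism, for ANY finite group action on the tensor space over a field whose
  characteristic divides `|G|`: `not_mem_orbitPiece_of_forall_smul_eq` (a non-zero `G`-FIXED tensor
  `D` lies in no piece `G·λ_X X`: it "would be generated `|G|` times, so it becomes `0`"),
  `OrbitMoveVia.mem_iff_of_fixed` (`D ∈ S ↔ D ∈ S'` along every orbit move, either direction),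
  `moosbauerPoole2025_no_path_of_fixed` (no path, even undirected, from a scheme avoiding `D` to one
  containing `D`).
* The printed example: `K = 𝔽₂`, `n = 2`, `G = C₃ × ℤ₂ = ⟨g⟩` of order `6` (MP's generator, tree
  `DiagonalStart.gSym` with the reversal, acting by `Symmetry.cyclicAction`),
  `D = (a₁₁+a₂₂)⊗(b₁₁+b₂₂)⊗(c₁₁+c₂₂)` (`StrassenF2.D`, fixed by `g`, an element of the tree's Strassen
  scheme mod 2 `StdToStrassenZ2.strassen`, which is itself a vertex: `StrassenF2.strassen_invariant`):
  **`moosbauerPoole2025_strassen_unreachable`** — from any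
  scheme of `⟨2,2,2⟩` over `𝔽₂` not containing `D` there is no path of orbit flips / reductions /
  plus-transitions (in either direction) to Strassen's algorithm.

Faithfulness notes. (1) MP's schemes are sets of rank-one tensors of `n × n` matrix multiplication;
as everywhere in the tree we use KM Def. 1's multiset reading and an arbitrary 3-tensor `t`. (2) On a
pair `{T₁, T₂}` KM's `Flips` is exactly MP Def. 3's flip "for arbitrary permutations of `A, B, C`";
KM's `Reduces` on a pair contains MP's reduction `A⊗B⊗C, A⊗B⊗C' ↦ A⊗B⊗(C+C')` (MP: "The original
definition of a reduction in [KM] is more general"); on a two-element multiset both replace the pair by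
rank-one tensors with the same sum, which is all that is used here. (3) The non-connectivity theorems
are proved for the union `OrbitAdj` WITHOUT assuming the start vertex invariant and for undirected
paths (`Relation.EqvGen`), which is stronger than the printed directed statement on `V`.

## References

* J. Moosbauer, M. Poole, *Flip Graphs with Symmetry and New Matrix Multiplication Schemes*,
  Proc. ISSAC 2025, doi:10.1145/3747199.3747566, arXiv:2502.04514: §3 Def. 3, Thm. 4, Def. 5 and the
  paragraph following it; §4 first paragraph. [MoosbauerPoole2025]
* M. Kauers, J. Moosbauer, *Flip Graphs for Matrix Multiplication*, ISSAC 2023, arXiv:2212.01175,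
  Def. 1, Def. 2, Def. 4. [KauersMoosbauer2022FlipGraphs]
* V. Strassen, *Gaussian elimination is not optimal*, Numer. Math. 13 (1969) 354–356. [Strassen1969]
-/

namespace Literature.Computability.AlgebraicComplexity

open scoped BigOperators
open Multiset

namespace FlipGraph

/-! ## §1 MP Def. 3 plus-transitions of a pair (all slot permutations) -/

section Plus

variable {K : Type*} [CommRing K] {ι κ μ : Type*}

/-- **MP Def. 3, plus-transition, the case written out:** the pair `U = {A⊗B⊗C, A'⊗B'⊗C'}` is
replaced by `P = {(A−A')⊗B⊗C, A'⊗B⊗(C+C'), A'⊗(B'−B)⊗C'}`. [cite: MoosbauerPoole2025, Def. 3] -/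
def PlusBase (U P : Multiset (ι → κ → μ → K)) : Prop :=
  ∃ (a a' : ι → K) (b b' : κ → K) (c c' : μ → K),
    U = triad a b c ::ₘ {triad a' b' c'} ∧
      P = triad (a - a') b c ::ₘ triad a' b (c + c') ::ₘ {triad a' (b' - b) c'}

/-- **MP Def. 3, plus-transitions** ("These definitions apply for arbitrary permutations of `A, B`
and `C`"): the written case in each of the six arrangements of the slots (as for KM's `Reduces`).
[cite: MoosbauerPoole2025, Def. 3] -/
def PlusTransitions (U P : Multiset (ι → κ → μ → K)) : Prop :=
  PlusBase U P ∨ PlusBase (U.map sw₂₃) (P.map sw₂₃) ∨ PlusBase (U.map sw₁₂) (P.map sw₁₂) ∨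
    PlusBase (U.map cyc) (P.map cyc) ∨ PlusBase (U.map cyc₂) (P.map cyc₂) ∨
    PlusBase (U.map sw₁₃) (P.map sw₁₃)

/-- A plus-transition of a pair keeps the sum, written case. [cite: MoosbauerPoole2025, Def. 3] -/
theorem PlusBase.sum_eq {U P : Multiset (ι → κ → μ → K)} (h : PlusBase U P) : P.sum = U.sum := by
  obtain ⟨a, a', b, b', c, c', rfl, rfl⟩ := h
  simp only [Multiset.sum_cons, Multiset.sum_singleton]
  rw [triad_add_triad_eq_plusTransition a a' b b' c c']
  abel

/-- A plus-transition of a pair produces three elements, written case.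
[cite: MoosbauerPoole2025, Def. 3] -/
theorem PlusBase.card_eq {U P : Multiset (ι → κ → μ → K)} (h : PlusBase U P) :
    card P = 3 ∧ card U = 2 := by
  obtain ⟨a, a', b, b', c, c', rfl, rfl⟩ := h
  simp

/-- All six arrangements produce three elements from two. [cite: MoosbauerPoole2025, Def. 3] -/
theorem PlusTransitions.card_eq {U P : Multiset (ι → κ → μ → K)} (h : PlusTransitions U P) :
    card P = 3 ∧ card U = 2 := by
  rcases h with h | h | h | h | h | h
  · exact h.card_eq
  all_goals simpa only [Multiset.card_map] using h.card_eq

end Plus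

/-! ## §2 MP Def. 5: orbit moves and the flip graph with symmetry -/

section Moves

variable {K : Type*} [Field K] {ι κ μ : Type*} {t : ι → κ → μ → K}
variable (G : Type*) [Group G] [Fintype G] [DecidableEq (ι → κ → μ → K)]
  [DistribMulAction G (ι → κ → μ → K)]

/-- **The common shape of MP's three operations (Thm. 4 and the paragraph after its proof):**
`S'` is obtained from `S` by replacing the two full orbits of the representatives `T₁, T₂ ∈ S`
(different orbits, both of size `|G|`) by the pieces `Σ_{X ∈ P} G·λ_X X` of a multiset `P` with
`Σ P = T₁ + T₂` — `S' = S ∖ (G·T₁ ∪ G·T₂) ∪ ⋃_{X∈P} G·λ_X X` in the multiset reading, zero pieces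
absent. [cite: MoosbauerPoole2025, Thm. 4 (statement and the paragraph after the proof)] -/
structure OrbitMoveVia (S S' : Scheme t) (T₁ T₂ : ι → κ → μ → K)
    (P : Multiset (ι → κ → μ → K)) : Prop where
  /-- `T₁ ∈ S` -/
  mem₁ : T₁ ∈ S.elts
  /-- `T₂ ∈ S` -/
  mem₂ : T₂ ∈ S.elts
  /-- the orbit of `T₁` has size `|G|` -/
  card₁ : (orbitFinset G T₁).card = Fintype.card G
  /-- the orbit of `T₂` has size `|G|` -/
  card₂ : (orbitFinset G T₂).card = Fintype.card G
  /-- `T₁, T₂` represent different orbits -/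
  not_mem : T₂ ∉ orbitFinset G T₁
  /-- the move of the pair keeps the sum -/
  sum_eq : P.sum = T₁ + T₂
  /-- `S' = S − (G·T₁ + G·T₂) + Σ_{X∈P} G·λ_X X` -/
  elts_eq : S'.elts = S.elts - ((orbitFinset G T₁).val + (orbitFinset G T₂).val) +
    P.bind (orbitPiece G)

/-- **`E₁`: "`S'` is an orbit flip of `S`"** — the pair of representatives is replaced by a flip of it
(KM Def. 4 / MP Def. 3, any arrangement of the slots), orbit-wise.
[cite: MoosbauerPoole2025, Def. 5 (with Thm. 4)] -/
def OrbitFlip (S S' : Scheme t) : Prop :=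
  ∃ (T₁ T₂ : ι → κ → μ → K) (P : Multiset (ι → κ → μ → K)),
    Flips (T₁ ::ₘ {T₂}) P ∧ OrbitMoveVia G S S' T₁ T₂ P

/-- **`E₂`: "`S'` is an orbit reduction of `S`"** — the pair of representatives is replaced by a
reduction of it, orbit-wise. [cite: MoosbauerPoole2025, Def. 5 (with Def. 3 and the paragraph after Thm. 4)] -/
def OrbitReduction (S S' : Scheme t) : Prop :=
  ∃ (T₁ T₂ : ι → κ → μ → K) (P : Multiset (ι → κ → μ → K)),
    Reduces (T₁ ::ₘ {T₂}) P ∧ OrbitMoveVia G S S' T₁ T₂ P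

/-- **`E₃`: "`S'` is an orbit plus-transition of `S`"** — the pair of representatives is replaced by
a plus-transition of it, orbit-wise.
[cite: MoosbauerPoole2025, Def. 5 (with Def. 3 and the paragraph after Thm. 4)] -/
def OrbitPlusTransition (S S' : Scheme t) : Prop :=
  ∃ (T₁ T₂ : ι → κ → μ → K) (P : Multiset (ι → κ → μ → K)),
    PlusTransitions (T₁ ::ₘ {T₂}) P ∧ OrbitMoveVia G S S' T₁ T₂ P

/-- **The edge set `E₁ ∪ E₂ ∪ E₃`** on schemes. [cite: MoosbauerPoole2025, Def. 5] -/
def OrbitAdj (S S' : Scheme t) : Prop :=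
  OrbitFlip G S S' ∨ OrbitReduction G S S' ∨ OrbitPlusTransition G S S'

/-- **MP Def. 5 — the `(n,n,n)`-flip graph with symmetry group `G`:** "Let `V` be the set of
`G`-invariant … schemes … The graph `(V, E₁ ∪ E₂ ∪ E₃)`"; here for any 3-tensor `t` and a finite group
acting by the symmetries `ρ g` (MP Def. 2 invariance = tree `IsInvariantUnder (Set.range ρ)`).
[cite: MoosbauerPoole2025, Def. 5] -/
def flipGraphSym (ρ : G → Symmetry t)
    (S S' : {S : Scheme t // IsInvariantUnder (Set.range ρ) S}) : Prop :=
  OrbitAdj G S.1 S'.1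

variable {G}

/-- Every edge of `E₁ ∪ E₂ ∪ E₃` is an orbit move along some pair move `P`.
[cite: MoosbauerPoole2025, Def. 5 (with Thm. 4)] -/
theorem OrbitAdj.exists_via {S S' : Scheme t} (h : OrbitAdj G S S') :
    ∃ (T₁ T₂ : ι → κ → μ → K) (P : Multiset (ι → κ → μ → K)), OrbitMoveVia G S S' T₁ T₂ P := by
  rcases h with ⟨T₁, T₂, P, -, h⟩ | ⟨T₁, T₂, P, -, h⟩ | ⟨T₁, T₂, P, -, h⟩ <;> exact ⟨T₁, T₂, P, h⟩

/-- **The three operations stay inside `V`** (MP Thm. 4: "`S'` … is a `G`-invariant … scheme",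
"Theorem 4 also holds for reductions and plus-transitions"): if `G` acts by the symmetries `ρ g`
and `S` is `G`-invariant, so is `S'`. [cite: MoosbauerPoole2025, Thm. 4 (and the paragraph after its proof)] -/
theorem OrbitMoveVia.isInvariantUnder (ρ : G → Symmetry t)
    (hρ : ∀ (g : G) (T : ι → κ → μ → K), (ρ g).toLinearEquiv T = g • T)
    {S S' : Scheme t} {T₁ T₂ : ι → κ → μ → K} {P : Multiset (ι → κ → μ → K)}
    (h : OrbitMoveVia G S S' T₁ T₂ P) (hS : IsInvariantUnder (Set.range ρ) S) :
    IsInvariantUnder (Set.range ρ) S' := by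
  have hinv := (isInvariantUnder_range_iff ρ hρ S).mp hS
  have hdec := eq_orbits_add_sub hinv h.mem₁ h.mem₂ h.not_mem
  obtain ⟨-, hinv'⟩ := orbitMove_pieces P hdec hinv h.card₁ h.card₂ h.sum_eq.symm
  refine (isInvariantUnder_range_iff ρ hρ S').mpr fun g => ?_
  rw [h.elts_eq]
  exact hinv' g

/-- An edge of the flip graph with symmetry leads from a `G`-invariant scheme to a `G`-invariant
scheme. [cite: MoosbauerPoole2025, Def. 5 (with Thm. 4)] -/
theorem OrbitAdj.isInvariantUnder (ρ : G → Symmetry t)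
    (hρ : ∀ (g : G) (T : ι → κ → μ → K), (ρ g).toLinearEquiv T = g • T)
    {S S' : Scheme t} (h : OrbitAdj G S S') (hS : IsInvariantUnder (Set.range ρ) S) :
    IsInvariantUnder (Set.range ρ) S' := by
  obtain ⟨T₁, T₂, P, h⟩ := h.exists_via
  exact h.isInvariantUnder ρ hρ hS

/-- **Rank bookkeeping of an orbit move** of a `G`-invariant `S`: `|S'| + 2|G| = |S| + |pieces|`.
[cite: MoosbauerPoole2025, Thm. 4 (proof) and §4 ("schemes of rank `k·|G| + |𝒫|`")] -/
theorem OrbitMoveVia.rank_eq {S S' : Scheme t} {T₁ T₂ : ι → κ → μ → K}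
    {P : Multiset (ι → κ → μ → K)} (h : OrbitMoveVia G S S' T₁ T₂ P)
    (hinv : ∀ g : G, S.elts.map (fun Y => g • Y) = S.elts) :
    S'.rank + 2 * Fintype.card G = S.rank + card (P.bind (orbitPiece G)) := by
  have hdec := eq_orbits_add_sub hinv h.mem₁ h.mem₂ h.not_mem
  have hc := congrArg card hdec
  simp only [Multiset.card_add, Finset.card_val, h.card₁, h.card₂] at hc
  simp only [Scheme.rank, h.elts_eq, Multiset.card_add]
  omega

/-! ## §3 Elements with small orbits are never removed (MP §4) -/

/-- **MP §4: "Such rank-one tensors will not be replaced when we follow a path in the flip graph"** —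
an element of `S` whose orbit has fewer than `|G|` elements (e.g. a `C₃`-invariant standard product
`a_{ii}⊗b_{ii}⊗c_{ii}`) survives every orbit flip / reduction / plus-transition, because these remove
only orbits of size `|G|`. [cite: MoosbauerPoole2025, §4 (first paragraph)] -/
theorem OrbitMoveVia.mem_of_card_lt {S S' : Scheme t} {T₁ T₂ : ι → κ → μ → K}
    {P : Multiset (ι → κ → μ → K)} (h : OrbitMoveVia G S S' T₁ T₂ P) {Y : ι → κ → μ → K}
    (hY : Y ∈ S.elts) (hsmall : (orbitFinset G Y).card < Fintype.card G) : Y ∈ S'.elts := by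
  have h₁ : Y ∉ orbitFinset G T₁ := fun hm => by
    rw [orbitFinset_eq_of_mem hm, h.card₁] at hsmall
    exact lt_irrefl _ hsmall
  have h₂ : Y ∉ orbitFinset G T₂ := fun hm => by
    rw [orbitFinset_eq_of_mem hm, h.card₂] at hsmall
    exact lt_irrefl _ hsmall
  rw [h.elts_eq]
  refine Multiset.mem_add.mpr (Or.inl ?_)
  rw [← Multiset.count_pos, Multiset.count_sub, Multiset.count_add,
    Multiset.count_eq_zero_of_notMem (mt Finset.mem_val.mp h₁),
    Multiset.count_eq_zero_of_notMem (mt Finset.mem_val.mp h₂), add_zero, Nat.sub_zero,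
    Multiset.count_pos]
  exact hY

/-- The same along any edge of `E₁ ∪ E₂ ∪ E₃`. [cite: MoosbauerPoole2025, §4 (first paragraph)] -/
theorem OrbitAdj.mem_of_card_lt {S S' : Scheme t} (h : OrbitAdj G S S') {Y : ι → κ → μ → K}
    (hY : Y ∈ S.elts) (hsmall : (orbitFinset G Y).card < Fintype.card G) : Y ∈ S'.elts := by
  obtain ⟨T₁, T₂, P, h⟩ := h.exists_via
  exact h.mem_of_card_lt hY hsmall

/-! ## §4 Characteristic dividing `|G|`: fixed tensors are never generated -/

/-- The orbit of a `G`-fixed tensor is a single point. [folklore] -/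
private theorem orbitFinset_eq_singleton_of_fixed {D : ι → κ → μ → K} (hfix : ∀ g : G, g • D = D) :
    orbitFinset G D = {D} := by
  ext Y
  rw [mem_orbitFinset, Finset.mem_singleton]
  constructor
  · rintro ⟨g, rfl⟩
    exact hfix g
  · rintro rfl
    exact ⟨1, one_smul _ _⟩

/-- **"Any flip, reduction or plus-transition that generates this rank-one tensor would generate it
`6` times, so it becomes `0` over `F₂`"** — general form: if the characteristic of `K` divides `|G|`
(`(|G| : K) = 0`), a non-zero tensor `D` fixed by all of `G` lies in NO piece `G·λ_X X`
(`λ_X = |G| / |G·X|`): if `g • (λ_X X) = D` then `λ_X X = D` is fixed, so is `X`, so `λ_X = |G| = 0`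
in `K` and the piece is empty. [cite: MoosbauerPoole2025, §3 (paragraph after Def. 5)] -/
theorem not_mem_orbitPiece_of_forall_smul_eq {D : ι → κ → μ → K} (hfix : ∀ g : G, g • D = D)
    (hchar : ((Fintype.card G : ℕ) : K) = 0) (X : ι → κ → μ → K) : D ∉ orbitPiece G X := by
  intro hD
  obtain ⟨h0, g, hg⟩ := mem_orbitPiece.mp hD
  set n := orbitCoeff G X with hn
  -- `n • X = g⁻¹ • D = D` is fixed by `G`
  have hnX : n • X = D := by
    have := congrArg (fun Y => g⁻¹ • Y) hg
    simp only [inv_smul_smul, hfix] at this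
    exact this.symm
  -- `(n : K) ≠ 0`, since `n • X ≠ 0`
  have hnK : (n : K) ≠ 0 := fun h => h0 (by rw [← Nat.cast_smul_eq_nsmul K n X, h, zero_smul])
  -- hence `X` itself is fixed by `G`
  have hXfix : ∀ h : G, h • X = X := fun h => by
    have e : (n : K) • (h • X) = (n : K) • X := by
      rw [Nat.cast_smul_eq_nsmul, Nat.cast_smul_eq_nsmul, ← smul_comm h n X, hnX, hfix]
    exact smul_right_injective _ hnK e
  -- so `|G · X| = 1` and `n = |G|`, which vanishes in `K`
  have hcard : (orbitFinset G X).card = 1 := by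
    rw [orbitFinset_eq_singleton_of_fixed hXfix, Finset.card_singleton]
  have hnG : n = Fintype.card G := by
    rw [hn, orbitCoeff, hcard, Nat.div_one]
  exact hnK (by rw [hnG, hchar])

/-- Along an orbit move a `G`-fixed non-zero tensor `D` is neither generated (previous theorem) nor
removed (its orbit `{D}` is smaller than `|G| ≥ 2`), when the characteristic divides `|G|`.
[cite: MoosbauerPoole2025, §3 (paragraph after Def. 5)] -/
theorem OrbitMoveVia.mem_iff_of_fixed {S S' : Scheme t} {T₁ T₂ : ι → κ → μ → K}
    {P : Multiset (ι → κ → μ → K)} (h : OrbitMoveVia G S S' T₁ T₂ P) {D : ι → κ → μ → K}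
    (hfix : ∀ g : G, g • D = D) (hchar : ((Fintype.card G : ℕ) : K) = 0) :
    D ∈ S.elts ↔ D ∈ S'.elts := by
  constructor
  · intro hD
    refine h.mem_of_card_lt hD ?_
    rw [orbitFinset_eq_singleton_of_fixed hfix, Finset.card_singleton]
    rcases Nat.lt_or_ge 1 (Fintype.card G) with hlt | hle
    · exact hlt
    · exfalso
      have h1 : Fintype.card G = 1 := le_antisymm hle Fintype.card_pos
      rw [h1, Nat.cast_one] at hchar
      exact one_ne_zero hchar
  · intro hD
    rw [h.elts_eq] at hD
    rcases Multiset.mem_add.mp hD with hD | hD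
    · exact Multiset.mem_of_le (Multiset.sub_le_self _ _) hD
    · obtain ⟨X, -, hX⟩ := Multiset.mem_bind.mp hD
      exact absurd hX (not_mem_orbitPiece_of_forall_smul_eq hfix hchar X)

/-- The same along any edge of `E₁ ∪ E₂ ∪ E₃`. [cite: MoosbauerPoole2025, §3 (paragraph after Def. 5)] -/
theorem OrbitAdj.mem_iff_of_fixed {S S' : Scheme t} (h : OrbitAdj G S S') {D : ι → κ → μ → K}
    (hfix : ∀ g : G, g • D = D) (hchar : ((Fintype.card G : ℕ) : K) = 0) :
    D ∈ S.elts ↔ D ∈ S'.elts := by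
  obtain ⟨T₁, T₂, P, h⟩ := h.exists_via
  exact h.mem_iff_of_fixed hfix hchar

/-- … and along any UNDIRECTED path in the flip graph with symmetry.
[cite: MoosbauerPoole2025, §3 (paragraph after Def. 5)] -/
theorem mem_iff_of_eqvGen_orbitAdj {S S' : Scheme t} (h : Relation.EqvGen (OrbitAdj G) S S')
    {D : ι → κ → μ → K} (hfix : ∀ g : G, g • D = D) (hchar : ((Fintype.card G : ℕ) : K) = 0) :
    D ∈ S.elts ↔ D ∈ S'.elts := by
  induction h with
  | rel x y hxy => exact hxy.mem_iff_of_fixed hfix hchar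
  | refl x => exact Iff.rfl
  | symm x y _ ih => exact ih.symm
  | trans x y z _ _ ih₁ ih₂ => exact ih₁.trans ih₂

/-- **"certain schemes cannot be connected in the flip graph"** (MP, after Def. 5), general form: if
the characteristic of `K` divides `|G|` and the non-zero tensor `D` is fixed by `G`, then no sequence
of orbit flips, orbit reductions and orbit plus-transitions (taken in either direction) leads from a
scheme not containing `D` to a scheme containing `D`. [cite: MoosbauerPoole2025, §3 (paragraph after Def. 5)] -/
theorem moosbauerPoole2025_no_path_of_fixed {S S' : Scheme t} {D : ι → κ → μ → K}
    (hfix : ∀ g : G, g • D = D) (hchar : ((Fintype.card G : ℕ) : K) = 0)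
    (hS : D ∉ S.elts) (hS' : D ∈ S'.elts) : ¬ Relation.EqvGen (OrbitAdj G) S S' :=
  fun h => hS ((mem_iff_of_eqvGen_orbitAdj h hfix hchar).mpr hS')

end Moves

/-! ## §5 The printed example: `K = 𝔽₂`, `n = 2`, `G = C₃ × ℤ₂`, Strassen's algorithm -/

namespace StrassenF2

open StdToStrassenZ2 DiagonalStart

/-- The reversal `i ↦ n+1−i` on `{1,2}` (MP's `ℤ₂`). [cite: MoosbauerPoole2025, §2 (`C₃ × ℤ₂`)] -/
def σ : Equiv.Perm (Fin 2) := Equiv.swap 0 1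

/-- `σ` is an involution. [cite: MoosbauerPoole2025, §2 (`C₃ × ℤ₂`)] -/
theorem σ_invol : ∀ i : Fin 2, σ (σ i) = i := by decide

/-- **MP's group `C₃ × ℤ₂ = ⟨g⟩` (order `6`) acting on `2×2×2` tensors over `𝔽₂`** by the symmetries
`g^k`, `g` = cyclic shift followed by the reversal relabelling (`DiagonalStart.gSym σ`, `g⁶ = id`).
[cite: MoosbauerPoole2025, §2 and Lemma 7 (proof, the generator `g` of `C₃ × ℤ₂`)] -/
@[reducible] noncomputable def action : DistribMulAction (Multiplicative (ZMod 6)) T :=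
  (gSym (K := ZMod 2) σ).cyclicAction 6 (gSym_iterate_six σ_invol)

attribute [local instance] action

/-- The diagonal `e₁₁ + e₂₂` of a `2 × 2` matrix slot. [cite: MoosbauerPoole2025, §3 (the tensor
`(a₁₁+a₂₂)(b₁₁+b₂₂)(c₁₁+c₂₂)`)] -/
def diag : Fin 2 × Fin 2 → ZMod 2 := posInd (ZMod 2) 0 0 + posInd (ZMod 2) 1 1

/-- **`D = (a₁₁+a₂₂) ⊗ (b₁₁+b₂₂) ⊗ (c₁₁+c₂₂)`** over `𝔽₂` (Strassen's first product).
[cite: MoosbauerPoole2025, §3 (paragraph after Def. 5)] -/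
def D : T := triad diag diag diag

/-- "Strassen's algorithm contains the rank-one tensor `(a₁₁+a₂₂)(b₁₁+b₂₂)(c₁₁+c₂₂)`" (it is the
product `M₁` of the tree's `strassen`). [cite: MoosbauerPoole2025, §3 (paragraph after Def. 5)] -/
theorem D_mem_strassen : D ∈ strassen.elts := by
  show D ∈ strassenElts
  unfold strassenElts
  exact Multiset.mem_map.mpr ⟨0, Finset.mem_val.mpr (Finset.mem_univ _), rfl⟩

/-- `D ≠ 0`. [cite: MoosbauerPoole2025, §3 (a rank-one tensor)] -/
theorem D_ne_zero : D ≠ 0 := strassen.ne_zero D D_mem_strassen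

/-- `D` is fixed by MP's generator `g` (it is `C₃ × ℤ₂`-invariant).
[cite: MoosbauerPoole2025, §3 (paragraph after Def. 5)] -/
theorem gSym_D : (gSym (K := ZMod 2) σ).toLinearEquiv D = D := by
  rw [D, gSym_triad]
  have h₁ : (fun p : Fin 2 × Fin 2 => diag (σ p.2, σ p.1)) = diag := by decide
  have h₂ : (fun p : Fin 2 × Fin 2 => diag (σ p.1, σ p.2)) = diag := by decide
  rw [h₁, h₂]

/-- Hence `D` is fixed by the whole group `⟨g⟩`. [cite: MoosbauerPoole2025, §3 (paragraph after Def. 5)] -/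
theorem smul_D (g : Multiplicative (ZMod 6)) : g • D = D := by
  rw [← Symmetry.cyclicRep_smul, Symmetry.cyclicRep_apply]
  exact Function.iterate_fixed gSym_D _

/-- `|C₃ × ℤ₂| = 6 = 0` in `𝔽₂` ("would generate it `6` times, so it becomes `0` over `F₂`").
[cite: MoosbauerPoole2025, §3 (paragraph after Def. 5)] -/
theorem card_eq_zero : ((Fintype.card (Multiplicative (ZMod 6)) : ℕ) : ZMod 2) = 0 := by
  rw [Fintype.card_multiplicative, ZMod.card]
  decide

/-- `D` lies in no piece `G·λ_X X` of any orbit move over `𝔽₂`.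
[cite: MoosbauerPoole2025, §3 (paragraph after Def. 5)] -/
theorem D_not_mem_orbitPiece (X : T) : D ∉ orbitPiece (Multiplicative (ZMod 6)) X :=
  not_mem_orbitPiece_of_forall_smul_eq smul_D card_eq_zero X

/-- Two schemes with the same elements are equal (bookkeeping). [folklore] -/
private theorem scheme_ext₅ {x y : Scheme (matMulTensor (ZMod 2) 2 2 2)} (h : x.elts = y.elts) :
    x = y := by
  cases x; cases y; cases h; rfl

/-- The image of Strassen's `r`-th product under `g`, read off from `gSym_triad`. [folklore] -/
private def img (r : Fin 7) : T :=
  triad (fun p : Fin 2 × Fin 2 => strassenU (ZMod 2) r (σ p.2, σ p.1))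
    (fun p => strassenV (ZMod 2) r (σ p.1, σ p.2))
    (fun p => strassenW (ZMod 2) r (σ p.2, σ p.1))

/-- `g` permutes Strassen's seven products (checked by evaluation). [folklore] -/
private theorem map_img_eq : (Finset.univ : Finset (Fin 7)).val.map img = strassenElts := by
  decide

/-- **Strassen's algorithm (mod 2) is `C₃ × ℤ₂`-invariant for MP's generator `g`:** `g · S = S`
("a `C₃ × ℤ₂`-invariant `2 × 2` matrix multiplication algorithm, like Strassen").
[cite: MoosbauerPoole2025, §3 (paragraph after Lemma 7)] -/
theorem strassen_map_gSym : strassen.map (gSym (K := ZMod 2) σ) = strassen := by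
  refine scheme_ext₅ ?_
  rw [Scheme.map_elts]
  show strassenElts.map (gSym (K := ZMod 2) σ).toLinearEquiv = strassenElts
  conv_rhs => rw [← map_img_eq]
  unfold strassenElts
  rw [Multiset.map_map]
  refine Multiset.map_congr rfl fun r _ => ?_
  exact gSym_triad σ _ _ _

/-- Hence Strassen's algorithm is a VERTEX of the `(2,2,2)`-flip graph with symmetry group
`C₃ × ℤ₂ = ⟨g⟩` over `𝔽₂` (MP Def. 5: `V` = the `G`-invariant schemes).
[cite: MoosbauerPoole2025, Def. 5 and §3 (paragraph after Lemma 7)] -/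
theorem strassen_invariant :
    IsInvariantUnder (Set.range ((gSym (K := ZMod 2) σ).cyclicRep 6)) strassen :=
  (gSym σ).isInvariantUnder_cyclicRep 6 strassen strassen_map_gSym

/-- **Moosbauer–Poole 2025, §3 (non-connectivity of the flip graph with symmetry over `𝔽₂`):**
"if we start from any `C₃ × ℤ₂` invariant `2 × 2` matrix multiplication scheme that does not already
contain `(a₁₁+a₂₂)(b₁₁+b₂₂)(c₁₁+c₂₂)` then there is no path to Strassen's algorithm in the flip
graph."  Typed for `G = C₃ × ℤ₂ = ⟨g⟩` acting on `2×2×2` tensors over `𝔽₂` (MP's generator, the local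
instance `StrassenF2.action`), for ANY start scheme `S` of `⟨2,2,2⟩` not containing `D` (invariant or
not), and for undirected paths of orbit flips, orbit reductions and orbit plus-transitions.
[cite: MoosbauerPoole2025, §3 (paragraph after Def. 5)] -/
theorem moosbauerPoole2025_strassen_unreachable (S : Scheme (matMulTensor (ZMod 2) 2 2 2))
    (hS : D ∉ S.elts) : ¬ Relation.EqvGen (OrbitAdj (Multiplicative (ZMod 6))) S strassen :=
  moosbauerPoole2025_no_path_of_fixed smul_D card_eq_zero hS D_mem_strassen

end StrassenF2

end FlipGraph

end Literature.Computability.AlgebraicComplexity
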